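import Summits.HodgeConjecture.HodgeConjecture.Theorems.MarkmanPartnerTransportPicardThreeK3SquaresKugaSatakePairClassMap
import Summits.HodgeConjecture.HodgeConjecture.Theorems.MarkmanPartnerTransportPicardThreeK3SquaresKugaSatakePairDescent
import Literature.AlgebraicGeometry.Motives.HodgeStructureK3RealMultProofs

/-!
# Route MarkmanPartnerTransport · crux `PicardThreeK3Squares` (stmt-HodgeConjecture-19652) —
# a rational Hodge SIMILITUDE `T(S) → T(S')` between TWO surfaces with `h^{2,0} = 1` is algebraic
# GRANTED the Kuga–Satake statements for `S` and `S'` (programme «KS-PAIR», assembly)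

Varesco (Math. Z. 305 (2023), Thm. 5.3 / Cor. 4.6): if the Kuga–Satake correspondences of two K3
surfaces are algebraic, every Hodge similarity of their transcendental lattices is algebraic — in the
tree the NAMED FACT `Surfaces.Varesco2023_transcendentalHodgeSimilitude_algebraic_of_kugaSatake_K3`.
Gen 14 («KS-SELF») proved the case `S' = S`; this file proves the general case, with Varesco's
deformation argument (Lemma 4.4) replaced by the SUBFIELD TRICK in the endomorphism field of `T(S')`:

* presentations `(T, P, ε, T ↪ H²_B(S))`, `(T, |m|·P, ε', T →ψ_T→ T' ↪ H²_B(S'))` on ONE abstract Hodge structure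
  (`…KugaSatakePairPresentation`) and ONE Kuga–Satake variety give algebraic `O₁ : H²(S) → H²(A × A)`,
  `O₂ : H²(S') → H²(A × A)` with `O₂ ∘ ψ = O₁` on `T(S)` (`…KugaSatakePairClassMap`); the Lefschetz–transpose
  `R = ᵗO₂ ∘ L^{n-2}` makes `f₁ = R ∘ O₁ : H²(S) → H²(S')`, `f₂ = R ∘ O₂ ∈ End H²(S')` algebraic with
  `f₂ ∘ ψ = f₁` on `T(S)` and `f₂ (ψσ) ≠ 0` (Hodge–Riemann);
* rational descent through a retraction `r : ℂ → ℚ` (`…KugaSatakePairDescent`): `a₂ ∘ ψ_T = a₁ ≠ 0` with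
  `a₁` induced by algebraic correspondences `S → S'` and `a₂ ∈ Rs'` (cycle-induced Hodge endomorphisms of
  `T'`) inside the FIELD `End_Hdg(T')` (Zarhin); the subfield trick gives `a₂⁻¹ ∈ Rs'`, so
  `ψ_T = a₂⁻¹ ∘ a₁` is induced by a composite of algebraic correspondences `S → S' → S'`;
* `exists_algebraicCorrespondence_eq_of_similitude_of_kugaSatake₂` — **THE THEOREM**: for smooth
  projective surfaces `S`, `S'` with `h^{2,0} = 1` whose Kuga–Satake correspondences are algebraic
  (`IsKSCorrespondenceAlgebraicBetti`, HYPOTHESES) and `ψ : H²(S(ℂ); ℂ) → H²(S'(ℂ); ℂ)` rational,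
  type-preserving, with image in `T(S')_ℂ`, mapping `T(S)_ℂ` injectively onto `T(S')_ℂ` and scaling the
  intersection forms there by a constant `μ ≠ 0`, SOME MAP INDUCED BY AN ALGEBRAIC CYCLE ON `S' × S`
  AGREES WITH `ψ` ON `T(S)_ℂ`.

CONDITIONAL only on the two Kuga–Satake hypotheses (open in print for general K3 surfaces); no named
fact, no definition, no sorry; nothing here says HC or the crux is proved. Prover seat
hodge-nonav-19652-p1 (gen 15), `--supports stmt-HodgeConjecture-19652`.

References: M. Varesco, Math. Z. 305 (2023), §0.3, Lemma 4.4, Thm. 4.5, Cor. 4.6, Thm. 5.3; D. Huybrechts,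
CMH 94 (2019), Rem. 3.3; Yu. G. Zarhin, Crelle 341 (1983), Thm. 1.5.1; W. Fulton, *Intersection Theory*, §16.1.
-/
set_option linter.dupNamespace false

noncomputable section

namespace Summit.HodgeConjecture.HodgeConjecture.Theorems.MarkmanPartnerTransport.KugaSatakePair

open scoped TensorProduct
open CategoryTheory MonoidalCategory Literature.AlgebraicGeometry Literature.AlgebraicGeometry.Motives
open Literature.AlgebraicGeometry.HodgeTheory Literature.AlgebraicTopology.SingularHomology
open Literature.AlgebraicGeometry.Motives.HodgeStructure
open Literature.AlgebraicGeometry.Surfaces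
open Summit.HodgeConjecture.HodgeConjecture.Theorems.OddPrimeSquares
open Summit.HodgeConjecture.HodgeConjecture.Theorems.MarkmanPartnerTransport.TranscendentalPresentation
open Summit.HodgeConjecture.HodgeConjecture.Theorems.MarkmanPartnerTransport.KugaSatakeSelf
open Summit.HodgeConjecture.HodgeConjecture.Ring2.AbelianAll

variable {S S' : SchemeOver ℂ}

/-- `H²_B(S)`: the weight-two `ℚ`-Hodge structure on `H²(S(ℂ); ℚ)` of the real Hodge model of `S`. -/
local notation3 "H²[" hS "]" =>
  bettiTwoHodgeStructure hS (BettiUniverse.realHodgeModel exists_isReal_hodgeModel_holds hS)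
    (BettiUniverse.realHodgeModel_isHodgeSymmetric exists_isReal_hodgeModel_holds hS)

/-- `T(S)_ℚ = Hdg¹^⊥ ⊆ H²(S(ℂ); ℚ)`. -/
local notation3 "T[" hS "]" =>
  transcendentalLatticeBetti hS (BettiUniverse.realHodgeModel exists_isReal_hodgeModel_holds hS)
    (BettiUniverse.realHodgeModel_isHodgeSymmetric exists_isReal_hodgeModel_holds hS)

/-- `Θ : ℂ ⊗_ℚ H²(S(ℂ); ℚ) → H²(S(ℂ); ℂ)`. -/
local notation3 "Θ[" S "]" => ofRatClassBaseChange (Motives.ComplexPoints S) (2 * 1)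
/-- `ι : H²(S(ℂ); ℚ) → H²(S(ℂ); ℂ)`, the rational lattice. -/
local notation3 "ι[" S "]" => ofRatClass (Motives.ComplexPoints S) (2 * 1)

/-- `Transc[S, y]`: `y` is cup-orthogonal to `N¹(S) = algebraicClasses S 1`. Local notation only. -/
local notation3 (prettyPrint := false) "Transc[" S ", " y "]" =>
  (∀ d ∈ algebraicClasses S 1, cupProduct (rfl : 2 * 1 + 2 * 1 = 2 * 2) y d = 0)

/-! ### The theorem -/

set_option maxHeartbeats 400000 in
/-- **A RATIONAL HODGE SIMILITUDE `T(S) → T(S')` IS ALGEBRAIC ON `T(S)`, GRANTED THE KUGA–SATAKE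
STATEMENTS FOR `S` AND `S'` — Varesco's Thm. 5.3 without the deformation argument.** Let `S`, `S'` be
smooth projective surfaces whose `(2,0)`-classes form lines `ℂσ`, `ℂσ'` with `σ, σ' ≠ 0`
(`h^{2,0} = 1`), whose Kuga–Satake correspondences are algebraic (`IsKSCorrespondenceAlgebraicBetti`,
HYPOTHESES, open in print for general K3 surfaces), and let `ψ : H²(S(ℂ); ℂ) → H²(S'(ℂ); ℂ)` be rational,
Hodge-type preserving, with every value cup-orthogonal to `N¹(S')`, injective on
`T(S)_ℂ = {y | y ⊥ N¹(S)}` and onto `T(S')_ℂ`, with `∫_{S'} ψy ∪ ψw = μ ∫_S y ∪ w` on `T(S)_ℂ` for a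
constant `μ ≠ 0`. Then some `ℂ`-linear `Φ : H²(S(ℂ); ℂ) → H²(S'(ℂ); ℂ)` INDUCED BY AN ALGEBRAIC CYCLE
on `S' × S` agrees with `ψ` on `T(S)_ℂ`. [cite: Varesco2023, Thm. 5.3, Cor. 4.6, Thm. 4.5 and §0.3]
[cite: Floccari2026, §3.3 Rem. 3.4] [cite: Zarhin1983HodgeGroupsK3, Thm. 1.5.1] -/
theorem exists_algebraicCorrespondence_eq_of_similitude_of_kugaSatake₂ (hS : IsSmoothProjective 2 S)
    (hS' : IsSmoothProjective 2 S')
    {σ : complexBetti S (2 * 1)} (hσ : IsOfHodgeType 2 S (2 * 1) 2 0 σ) (hσ0 : σ ≠ 0)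
    (hline : ∀ c : complexBetti S (2 * 1), IsOfHodgeType 2 S (2 * 1) 2 0 c → ∃ t : ℂ, c = t • σ)
    {σ' : complexBetti S' (2 * 1)} (hσ' : IsOfHodgeType 2 S' (2 * 1) 2 0 σ') (hσ'0 : σ' ≠ 0)
    (hline' : ∀ c : complexBetti S' (2 * 1), IsOfHodgeType 2 S' (2 * 1) 2 0 c → ∃ t : ℂ, c = t • σ')
    (hKS : IsKSCorrespondenceAlgebraicBetti hS) (hKS' : IsKSCorrespondenceAlgebraicBetti hS')
    (ψ : complexBetti S (2 * 1) →ₗ[ℂ] complexBetti S' (2 * 1))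
    (h1 : ∀ y, IsRationalClass y → IsRationalClass (ψ y))
    (h2 : ∀ (i j : ℕ) y, IsOfHodgeType 2 S (2 * 1) i j y → IsOfHodgeType 2 S' (2 * 1) i j (ψ y))
    (h4 : ∀ y : complexBetti S (2 * 1), Transc[S', ψ y])
    (hinj : ∀ y : complexBetti S (2 * 1), Transc[S, y] → ψ y = 0 → y = 0)
    (hsurj : ∀ y' : complexBetti S' (2 * 1), Transc[S', y'] → ∃ y, Transc[S, y] ∧ ψ y = y')
    {μ : ℂ} (hμ : μ ≠ 0)
    (hmul : ∀ y w : complexBetti S (2 * 1), Transc[S, y] → Transc[S, w] →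
      traceC hS' (cupProduct (rfl : 2 * 1 + 2 * 1 = 2 * 2) (ψ y) (ψ w)) =
        μ * traceC hS (cupProduct (rfl : 2 * 1 + 2 * 1 = 2 * 2) y w)) :
    ∃ Φ : complexBetti S (2 * 1) →ₗ[ℂ] complexBetti S' (2 * 1), IsAlgebraicCorrespondence 2 2 S' S Φ ∧
      ∀ y : complexBetti S (2 * 1), Transc[S, y] → Φ y = ψ y := by
  classical
  haveI := BettiUniverse.finite hS (2 * 1); haveI := BettiUniverse.finite hS' (2 * 1)
  -- the presentation of `S` and the transcendental sub-Hodge structure of `S'`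
  obtain ⟨T, P, ε, hT, hirr, hK3, h20, hj⟩ := exists_isTranscendentalPartBetti hS hσ hσ0 hline
  obtain ⟨T', hT', hirr', hK3', -⟩ := exists_transcendental_subHodgeStructure hS' hσ' hσ'0 hline'
  haveI := Module.Finite.of_injective T.toSubmodule.subtype T.toSubmodule.injective_subtype
  haveI := Module.Finite.of_injective T'.toSubmodule.subtype T'.toSubmodule.injective_subtype
  -- `ψ_T : Hom T T'`, bijective
  obtain ⟨ψT, hψT⟩ := exists_hom_transcendental₂ hS hS' T T' hT' ψ h1 h2 h4
  have hbij : Function.Bijective ψT.toLinearMap :=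
    hom_transcendental_bijective₂ hT hT' hψT (fun y _ => h4 y) hinj hsurj
  -- `σ = Θ(sub x₀)`, `x₀ ≠ 0`, and `T ≠ 0`
  obtain ⟨x₀, hx₀⟩ := exists_baseChange_eq_of_transc hS T hT (transc_of_twoZero hS hσ)
  have hx₀0 : x₀ ≠ 0 := by rintro rfl; exact hσ0 (by rw [← hx₀, map_zero, map_zero])
  have hT0 : T.toSubmodule ≠ ⊥ := by
    intro h0
    apply hx₀0
    have hall : ∀ x : ℂ ⊗[ℚ] T.toSubmodule, x = 0 := by
      intro x
      induction x using TensorProduct.induction_on with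
      | zero => rfl
      | tmul c t =>
        have ht : (t : bettiCohomology S (2 * 1)) ∈ (⊥ : Submodule ℚ (bettiCohomology S (2 * 1))) := h0 ▸ t.2
        rw [show t = 0 from Subtype.ext ((Submodule.mem_bot ℚ).1 ht), TensorProduct.tmul_zero]
      | add x y hx hy => rw [hx, hy, add_zero]
    exact hall x₀
  -- the rational multiplier and the transported presentation of `S'`
  obtain ⟨m, hm, hmulQ⟩ := exists_rat_multiplier₂ hS hS' hT hj hT0 hψT hμ hmul
  obtain ⟨ε', hj'⟩ := exists_isTranscendentalPartBetti_transport₂ hS hS' hT' hj hbij hm hmulQ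
  -- the two correspondences into one Kuga–Satake square
  obtain ⟨A, μK, O₁, O₂, hμK, hO₁, hO₂, hO₁j, hO₂j⟩ :=
    exists_two_correspondences_of_kugaSatake₂ hS hS' hKS hKS' hj hK3 (abs_pos.2 hm) hj'
  have hA : IsSmoothProjective A.dim A.X := AbelianVariety.isSmoothProjective_holds
  have hY : IsSmoothProjective (A.dim + A.dim) (A.X ⊗ A.X) := hA.tensor_holds hA
  have hn : 2 ≤ A.dim + A.dim := by
    have h := IsAlgebraicCorrespondence.le_two_mul hO₁
    omega
  -- the Lefschetz–transpose
  obtain ⟨R, hΦ₁, hΦ₂, hne⟩ := exists_lefschetzTranspose₂ hS hS' hY hn hO₁ hO₂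
  -- `j'' = ι_{T'} ∘ ψ_T` as a `ℚ`-linear map and its complexification
  set j'' : T.toSubmodule →ₗ[ℚ] bettiCohomology S' (2 * 1) := T'.toSubmodule.subtype ∘ₗ ψT.toLinearMap with hj''
  have hψx : ∀ x : ℂ ⊗[ℚ] T.toSubmodule, ψ (Θ[S] (T.toSubmodule.subtype.baseChange ℂ x)) =
      Θ[S'] (j''.baseChange ℂ x) := by
    intro x
    induction x using TensorProduct.induction_on with
    | zero => simp only [map_zero]
    | tmul c t =>
      rw [LinearMap.baseChange_tmul, Submodule.subtype_apply, ofRatClassBaseChange_tmul, map_smul,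
        LinearMap.baseChange_tmul, ofRatClassBaseChange_tmul, hj'', LinearMap.comp_apply, Submodule.subtype_apply, hψT]
    | add x y hx hy => simp only [map_add, hx, hy]
  -- `O₁` on `Θ(T_ℂ)` and `O₂` on `Θ'(j''(T)_ℂ)`
  have hO₁x : ∀ x : ℂ ⊗[ℚ] T.toSubmodule, O₁ (Θ[S] (T.toSubmodule.subtype.baseChange ℂ x)) =
      ofRatClassBaseChange (Motives.ComplexPoints (A.X ⊗ A.X)) 2 (μK.baseChange ℂ x) := by
    intro x
    induction x using TensorProduct.induction_on with
    | zero => simp only [map_zero]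
    | tmul c t =>
      rw [LinearMap.baseChange_tmul, Submodule.subtype_apply, ofRatClassBaseChange_tmul, map_smul,
        LinearMap.baseChange_tmul, ofRatClassBaseChange_tmul]
      exact congrArg _ (hO₁j t)
    | add x y hx hy => simp only [map_add, hx, hy]
  have hO₂x : ∀ x : ℂ ⊗[ℚ] T.toSubmodule, O₂ (Θ[S'] (j''.baseChange ℂ x)) =
      ofRatClassBaseChange (Motives.ComplexPoints (A.X ⊗ A.X)) 2 (μK.baseChange ℂ x) := by
    intro x
    induction x using TensorProduct.induction_on with
    | zero => simp only [map_zero]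
    | tmul c t =>
      rw [LinearMap.baseChange_tmul, ofRatClassBaseChange_tmul, map_smul, LinearMap.baseChange_tmul,
        ofRatClassBaseChange_tmul]
      exact congrArg _ (hO₂j t)
    | add x y hx hy => simp only [map_add, hx, hy]
  have hμC : Function.Injective (μK.baseChange ℂ) := by
    rw [LinearMap.baseChange_eq_ltensor]
    exact Module.Flat.lTensor_preserves_injective_linearMap _ hμK
  -- `O₂ (ψσ)` is a non-zero `(2,0)`-class with `O₂ \bar{ψσ} = \overline{O₂ ψσ}`
  have hO₂σ0 : O₂ (ψ σ) ≠ 0 := by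
    rw [← hx₀, hψx, hO₂x]
    exact fun h0 => hx₀0 (hμC (ofRatClassBaseChange_injective _ _ (by rw [h0, map_zero, map_zero])))
  have hO₂conj : O₂ (conjClass _ (2 * 1) (ψ σ)) = conjClass _ 2 (O₂ (ψ σ)) := by
    rw [← hx₀, hψx, ← ofRatClassBaseChange_conj_eq hS', conj_baseChange, hO₂x, hO₂x, ← conj_baseChange]
    exact KaehlerRationalDatum.ofRatClassBaseChange_conj hY
      (BettiUniverse.realHodgeModel exists_isReal_hodgeModel_holds hY) _
  have hΦ₂σ : (R ∘ₗ O₂) (ψ σ) ≠ 0 :=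
    hne (ψ σ) (isOfHodgeType_two_zero_of_isAlgebraicCorrespondence hY hS' hO₂ (h2 _ _ _ hσ)) hO₂σ0 hO₂conj
  -- `O₁ σ = O₂ (ψ σ)`, so `f₁ σ ≠ 0`
  have hO₁σ : O₁ σ = O₂ (ψ σ) := by rw [← hx₀, hO₁x, hψx, hO₂x]
  have hΦ₁σ : (R ∘ₗ O₁) σ ≠ 0 := by rw [LinearMap.comp_apply, hO₁σ]; exact hΦ₂σ
  -- `f₂ ∘ ψ = f₁` on `T(S)_ℚ`
  have hrel : ∀ t : T.toSubmodule, (R ∘ₗ O₂) (ψ (ι[S] (t : bettiCohomology S (2 * 1)))) =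
      (R ∘ₗ O₁) (ι[S] (t : bettiCohomology S (2 * 1))) := by
    intro t
    rw [LinearMap.comp_apply, LinearMap.comp_apply, ← hψT]
    exact congrArg R ((hO₂j t).trans (hO₁j t).symm)
  -- the cycle-induced Hodge endomorphisms of `T'` (self-correspondences of `S'`)
  let Rs : Submodule ℚ (Module.End ℚ T'.toSubmodule) :=
    { carrier := {a | a ∈ T'.toHodgeStructure.endAlg ∧
        ∃ f : complexBetti S' (2 * 1) →ₗ[ℂ] complexBetti S' (2 * 1), IsAlgebraicCorrespondence 2 2 S' S' f ∧
          ∀ t : T'.toSubmodule, f (ι[S'] (t : bettiCohomology S' (2 * 1))) =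
            ι[S'] ((a t : T'.toSubmodule) : bettiCohomology S' (2 * 1))}
      add_mem' := by
        rintro a b ⟨haE, f, hf, hfa⟩ ⟨hbE, f', hf', hfb⟩
        refine ⟨add_mem haE hbE, f + f', IsAlgebraicCorrespondence.add hS' hS' hf hf', fun t => ?_⟩
        rw [LinearMap.add_apply, hfa, hfb, LinearMap.add_apply, Submodule.coe_add, map_add]
      zero_mem' := by
        refine ⟨zero_mem _, 0, isAlgebraicCorrespondence_zero hS' hS' (e := 2) rfl (by norm_num), fun t => ?_⟩
        rw [LinearMap.zero_apply, LinearMap.zero_apply, Submodule.coe_zero, map_zero]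
      smul_mem' := by
        rintro c a ⟨haE, f, hf, hfa⟩
        refine ⟨Subalgebra.smul_mem _ haE c, (c : ℂ) • f, IsAlgebraicCorrespondence.smul hS' hS' hf _, fun t => ?_⟩
        rw [LinearMap.smul_apply, hfa, LinearMap.smul_apply, Submodule.coe_smul, Motives.ofRatClass_smul] }
  have hRsE : ∀ a ∈ Rs, a ∈ T'.toHodgeStructure.endAlg := fun a ha => ha.1
  have hRsmul : ∀ a ∈ Rs, ∀ b ∈ Rs, a * b ∈ Rs := by
    rintro a ⟨haE, f, hf, hfa⟩ b ⟨hbE, f', hf', hfb⟩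
    refine ⟨mul_mem haE hbE, f ∘ₗ f', IsAlgebraicCorrespondence.comp hS' hS' hS' hf' hf (by norm_num), fun t => ?_⟩
    rw [LinearMap.comp_apply, hfb, hfa, Module.End.mul_apply]
  -- the `ℚ`-linear maps `T → T'` induced by algebraic correspondences `S → S'`
  let Hs : Submodule ℚ (T.toSubmodule →ₗ[ℚ] T'.toSubmodule) :=
    { carrier := {a | ∃ f : complexBetti S (2 * 1) →ₗ[ℂ] complexBetti S' (2 * 1), IsAlgebraicCorrespondence 2 2 S' S f ∧
          ∀ t : T.toSubmodule, f (ι[S] (t : bettiCohomology S (2 * 1))) =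
            ι[S'] ((a t : T'.toSubmodule) : bettiCohomology S' (2 * 1))}
      add_mem' := by
        rintro a b ⟨f, hf, hfa⟩ ⟨f', hf', hfb⟩
        refine ⟨f + f', IsAlgebraicCorrespondence.add hS' hS hf hf', fun t => ?_⟩
        rw [LinearMap.add_apply, hfa, hfb, LinearMap.add_apply, Submodule.coe_add, map_add]
      zero_mem' := by
        refine ⟨0, isAlgebraicCorrespondence_zero hS' hS (e := 2) rfl (by norm_num), fun t => ?_⟩
        rw [LinearMap.zero_apply, LinearMap.zero_apply, Submodule.coe_zero, map_zero]
      smul_mem' := by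
        rintro c a ⟨f, hf, hfa⟩
        refine ⟨(c : ℂ) • f, IsAlgebraicCorrespondence.smul hS' hS hf _, fun t => ?_⟩
        rw [LinearMap.smul_apply, hfa, LinearMap.smul_apply, Submodule.coe_smul, Motives.ofRatClass_smul] }
  have hHsmul : ∀ a ∈ Hs, ∀ b ∈ Rs, b ∘ₗ a ∈ Hs := by
    rintro a ⟨f, hf, hfa⟩ b ⟨-, f', hf', hfb⟩
    refine ⟨f' ∘ₗ f, IsAlgebraicCorrespondence.comp hS' hS' hS hf hf' (by norm_num), fun t => ?_⟩
    rw [LinearMap.comp_apply, hfa, hfb, LinearMap.comp_apply]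
  -- `Θ'` as an equivalence, and the retractions `(r ⊗ 1) ∘ Θ'⁻¹`
  let Θe : (ℂ ⊗[ℚ] bettiCohomology S' (2 * 1)) ≃ₗ[ℂ] complexBetti S' (2 * 1) :=
    LinearEquiv.ofBijective (Θ[S']) ⟨ofRatClassBaseChange_injective _ _, ofRatClassBaseChange_surjective hS' (2 * 1)⟩
  have hΘe : ∀ x, Θe x = Θ[S'] x := fun _ => rfl
  have hΘe_symm : ∀ (c : ℂ) (w : bettiCohomology S' (2 * 1)), Θe.symm (c • ι[S'] w) = c ⊗ₜ[ℚ] w := by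
    intro c w
    apply Θe.injective
    rw [LinearEquiv.apply_symm_apply, hΘe, ofRatClassBaseChange_tmul]
  -- DESCENT (self): `(r ⊗ 1) Θ'⁻¹ f ι'` is a cycle-induced Hodge endomorphism of `T'`
  have hdesc : ∀ (r : ℂ →ₗ[ℚ] ℚ) {f : complexBetti S' (2 * 1) →ₗ[ℂ] complexBetti S' (2 * 1)},
      IsAlgebraicCorrespondence 2 2 S' S' f → ∃ a ∈ Rs, ∀ t : T'.toSubmodule,
        TensorProduct.lid ℚ _ (r.rTensor _ (Θe.symm (f (ι[S'] (t : bettiCohomology S' (2 * 1)))))) =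
          ((a t : T'.toSubmodule) : bettiCohomology S' (2 * 1)) := by
    intro r f hf
    obtain ⟨e, hab, γ, hγ, rfl⟩ := IsAlgebraicCorrespondence.exists_eq_corrAction hS' hS' hf
    suffices h : ∀ c : ℂ, ∃ a ∈ Rs, ∀ t : T'.toSubmodule,
        TensorProduct.lid ℚ _ (r.rTensor _ (Θe.symm
          (c • corrAction complexOrientationFamily hS' hS' hab γ (ι[S'] (t : bettiCohomology S' (2 * 1)))))) =
          ((a t : T'.toSubmodule) : bettiCohomology S' (2 * 1)) by
      obtain ⟨a, ha, h1⟩ := h 1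
      exact ⟨a, ha, fun t => by rw [← h1 t, one_smul]⟩
    have hγ' := (le_of_eq (supportedClasses_eq_span_isRationalClass (hS'.tensor_holds hS') (2 * e) e)) hγ
    clear hf hγ
    induction hγ' using Submodule.span_induction with
    | mem γ hγQ =>
      intro c
      obtain ⟨a, haE, ha⟩ := exists_endAlg_of_isRationalClass hS' T' hT' hab hγQ.2 hγQ.1
      have haR : a ∈ Rs :=
        ⟨haE, _, isAlgebraicCorrespondence_corrAction_complex hS' hS' hab (by norm_num) hγQ.2, ha⟩
      refine ⟨r c • a, Rs.smul_mem _ haR, fun t => ?_⟩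
      rw [ha t, hΘe_symm, lid_rTensor_tmul, LinearMap.smul_apply, Submodule.coe_smul]
    | zero =>
      intro c
      refine ⟨0, Rs.zero_mem, fun t => ?_⟩
      simp only [map_zero, LinearMap.zero_apply, smul_zero, Submodule.coe_zero]
    | add γ γ' _ _ h h' =>
      intro c
      obtain ⟨a, ha, hat⟩ := h c
      obtain ⟨a', ha', hat'⟩ := h' c
      refine ⟨a + a', Rs.add_mem ha ha', fun t => ?_⟩
      simp only [map_add, LinearMap.add_apply, smul_add, hat, hat', Submodule.coe_add]
    | smul c' γ _ h =>
      intro c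
      obtain ⟨a, ha, hat⟩ := h (c * c')
      refine ⟨a, ha, fun t => ?_⟩
      rw [(corrAction complexOrientationFamily hS' hS' hab).map_smul, LinearMap.smul_apply, smul_smul]
      exact hat t
  -- DESCENT (cross): `(r ⊗ 1) Θ'⁻¹ f ι` is induced by algebraic correspondences `S → S'`
  have hdescX : ∀ (r : ℂ →ₗ[ℚ] ℚ) {f : complexBetti S (2 * 1) →ₗ[ℂ] complexBetti S' (2 * 1)},
      IsAlgebraicCorrespondence 2 2 S' S f → ∃ a ∈ Hs, ∀ t : T.toSubmodule,
        TensorProduct.lid ℚ _ (r.rTensor _ (Θe.symm (f (ι[S] (t : bettiCohomology S (2 * 1)))))) =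
          ((a t : T'.toSubmodule) : bettiCohomology S' (2 * 1)) := by
    intro r f hf
    obtain ⟨e, hab, γ, hγ, rfl⟩ := IsAlgebraicCorrespondence.exists_eq_corrAction hS' hS hf
    suffices h : ∀ c : ℂ, ∃ a ∈ Hs, ∀ t : T.toSubmodule,
        TensorProduct.lid ℚ _ (r.rTensor _ (Θe.symm
          (c • corrAction complexOrientationFamily hS' hS hab γ (ι[S] (t : bettiCohomology S (2 * 1)))))) =
          ((a t : T'.toSubmodule) : bettiCohomology S' (2 * 1)) by
      obtain ⟨a, ha, h1⟩ := h 1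
      exact ⟨a, ha, fun t => by rw [← h1 t, one_smul]⟩
    have hγ' := (le_of_eq (supportedClasses_eq_span_isRationalClass (hS'.tensor_holds hS) (2 * e) e)) hγ
    clear hf hγ
    induction hγ' using Submodule.span_induction with
    | mem γ hγQ =>
      intro c
      obtain ⟨a, ha⟩ := exists_homAlg_of_isRationalClass₂ hS hS' T hT T' hT' hab hγQ.2 hγQ.1
      have haR : a.toLinearMap ∈ Hs :=
        ⟨_, isAlgebraicCorrespondence_corrAction_complex hS' hS hab (by norm_num) hγQ.2, ha⟩
      refine ⟨r c • a.toLinearMap, Hs.smul_mem _ haR, fun t => ?_⟩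
      rw [ha t, hΘe_symm, lid_rTensor_tmul, LinearMap.smul_apply, Submodule.coe_smul]
    | zero =>
      intro c
      refine ⟨0, Hs.zero_mem, fun t => ?_⟩
      simp only [map_zero, LinearMap.zero_apply, smul_zero, Submodule.coe_zero]
    | add γ γ' _ _ h h' =>
      intro c
      obtain ⟨a, ha, hat⟩ := h c
      obtain ⟨a', ha', hat'⟩ := h' c
      refine ⟨a + a', Hs.add_mem ha ha', fun t => ?_⟩
      simp only [map_add, LinearMap.add_apply, smul_add, hat, hat', Submodule.coe_add]
    | smul c' γ _ h =>
      intro c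
      obtain ⟨a, ha, hat⟩ := h (c * c')
      refine ⟨a, ha, fun t => ?_⟩
      rw [(corrAction complexOrientationFamily hS' hS hab).map_smul, LinearMap.smul_apply, smul_smul]
      exact hat t
  -- a rational vector of `T` where `f₁` does not vanish, and a retraction detecting it
  have hzero_or : ∃ t₀ : T.toSubmodule, (R ∘ₗ O₁) (ι[S] (t₀ : bettiCohomology S (2 * 1))) ≠ 0 := by
    by_contra hall
    push Not at hall
    have hzero : ∀ x : ℂ ⊗[ℚ] T.toSubmodule, (R ∘ₗ O₁) (Θ[S] (T.toSubmodule.subtype.baseChange ℂ x)) = 0 := by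
      intro x
      induction x using TensorProduct.induction_on with
      | zero => rw [map_zero, map_zero, map_zero]
      | tmul c t =>
        rw [LinearMap.baseChange_tmul, Submodule.subtype_apply, ofRatClassBaseChange_tmul, map_smul, hall t,
          smul_zero]
      | add x y hx hy => rw [map_add, map_add, map_add, hx, hy, add_zero]
    exact hΦ₁σ (by rw [← hx₀]; exact hzero x₀)
  obtain ⟨t₀, ht₀⟩ := hzero_or
  have hξ : Θe.symm ((R ∘ₗ O₁) (ι[S] (t₀ : bettiCohomology S (2 * 1)))) ≠ 0 := by
    intro h0
    have h := congrArg Θe h0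
    rw [LinearEquiv.apply_symm_apply, map_zero] at h
    exact ht₀ h
  obtain ⟨r, hr⟩ := exists_rat_retraction_ne_zero hξ
  -- the descended maps `a₁ ∈ Hs`, `a₂ ∈ Rs` with `a₂ ∘ ψ_T = a₁ ≠ 0`
  obtain ⟨a₁, ha₁R, ha₁⟩ := hdescX r hΦ₁
  obtain ⟨a₂, ha₂R, ha₂⟩ := hdesc r hΦ₂
  have ha₁0 : a₁ ≠ 0 := fun h0 => hr (by rw [ha₁ t₀, h0, LinearMap.zero_apply, Submodule.coe_zero])
  have hmulrel : a₂ ∘ₗ ψT.toLinearMap = a₁ := by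
    refine LinearMap.ext fun t => Subtype.ext ?_
    rw [LinearMap.comp_apply, ← ha₂, ← ha₁, hψT, hrel t]
  have ha₂0 : a₂ ≠ 0 := by rintro rfl; exact ha₁0 (by rw [← hmulrel, LinearMap.zero_comp])
  -- Zarhin: `End_Hdg(T')` is a field; the inverse of `a₂` lies in `Rs` by the subfield trick
  obtain ⟨hField, -⟩ := Zarhin1983_endAlg_isField_holds T'.toHodgeStructure hirr' hK3'
  have ha₂E : a₂ ∈ T'.toHodgeStructure.endAlg := hRsE _ ha₂R
  obtain ⟨b, hb⟩ := hField.mul_inv_cancel (show (⟨a₂, ha₂E⟩ : T'.toHodgeStructure.endAlg) ≠ 0 from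
    fun h0 => ha₂0 (congrArg Subtype.val h0))
  have hab : a₂ * (b : Module.End ℚ T'.toSubmodule) = 1 := by
    have h := congrArg Subtype.val hb
    simpa only [Subalgebra.coe_mul, Subalgebra.coe_one] using h
  have hba : (b : Module.End ℚ T'.toSubmodule) * a₂ = 1 := by
    have hc := hField.mul_comm ⟨a₂, ha₂E⟩ b
    rw [hc] at hb
    have h := congrArg Subtype.val hb
    simpa only [Subalgebra.coe_mul, Subalgebra.coe_one] using h
  have hbR : (b : Module.End ℚ T'.toSubmodule) ∈ Rs :=
    mem_of_mul_eq_of_isField hField Rs hRsE hRsmul ha₂R (hRsmul _ ha₂R _ ha₂R) b.2 ha₂0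
      (by rw [mul_assoc, hab]; exact mul_one a₂)
  obtain ⟨-, f₃, hf₃, hf₃b⟩ := hbR
  obtain ⟨f₁, hf₁, hf₁a⟩ := ha₁R
  -- `Φ = f₃ ∘ f₁`
  refine ⟨f₃ ∘ₗ f₁, IsAlgebraicCorrespondence.comp hS' hS' hS hf₁ hf₃ (by norm_num), fun y hy => ?_⟩
  have hpt : ∀ t : T.toSubmodule, (f₃ ∘ₗ f₁) (ι[S] (t : bettiCohomology S (2 * 1))) =
      ψ (ι[S] (t : bettiCohomology S (2 * 1))) := by
    intro t
    rw [LinearMap.comp_apply, hf₁a, hf₃b, ← hψT]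
    congr 2
    have h := congrArg (fun g : Module.End ℚ T'.toSubmodule => g (ψT.toLinearMap t)) hba
    simp only [Module.End.mul_apply, Module.End.one_apply] at h
    rw [← h]
    congr 1
    have h' := congrArg (fun g : T.toSubmodule →ₗ[ℚ] T'.toSubmodule => g t) hmulrel
    simp only [LinearMap.comp_apply] at h'
    exact h'.symm
  obtain ⟨x, rfl⟩ := exists_baseChange_eq_of_transc hS T hT hy
  clear hy
  induction x using TensorProduct.induction_on with
  | zero => rw [map_zero, map_zero, map_zero, map_zero]
  | tmul c t =>
    rw [LinearMap.baseChange_tmul, Submodule.subtype_apply, ofRatClassBaseChange_tmul, map_smul, map_smul, hpt t]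
  | add x y hx hy => rw [map_add, map_add, map_add, map_add, hx, hy]

end Summit.HodgeConjecture.HodgeConjecture.Theorems.MarkmanPartnerTransport.KugaSatakePair

end
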